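import Summits.QuantumFields.YangMills.Theorems.SwapVirialDeficitSectorLaplaceMbDensityDetFol
import Summits.QuantumFields.YangMills.Theorems.SwapVirialDeficitBlowUpGnomonicFibreRescaledSockets
import Summits.QuantumFields.YangMills.Theorems.SwapVirialDeficitBlowUpGnomonicFibreRescaledFloors
import HarnessLib

/-!
# Route `SwapVirialDeficit` (YangMills): THE RESCALED FOLLOWER-DETERMINANT FLOOR OF THE MORSE–BOTT DENSITY —
# `𝔪(a,ε,p) ≥ (1+x₀²)⁻¹(1+y₀²)⁻¹·((1+d)Λ)^{−7∕2}(1+1∕d)^{−d∕2}∕√det A_F(gnoBase p)`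
# (cell ym-idea-1, skeleton ➎; w2 g60 memo2 §1: the `(1+x₀²)(1+y₀²)` GAIN over ✓`mbDensity_ge_detFol` that the cores' leader-side bounds carry — via w2 g59's rescaled fibre
# letters ✓`gnoScale` (Jacobian `(1+x₀²)(1+y₀²)`, ✓`integral_comp_gnoScale`) and g47's size-normalised second jet ✓`taylor_four_chartDeficit_gnomonic`;
# free-hands support of ⟨stmt-QuantumFields-24197⟩ `SwapVirialDeficit.SwapGluedStiffness`)

* §1 ★ `fibQ_gnoScale_le` — THE RESCALED CEILING `Q_{a,ε,p}(gnoScale p y) ≤ 20400L⁴‖y‖²` for EVERY `p` (the transverse letters of a free leader near the equator are cheap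
  in gnomonic units: the normalised sizes of the rescaled point are `≤ ‖y‖`, ✓`letterSizes_rescaled_le`); `gnoScale_ι₂` (the rescaling fixes the follower block).
* §2 ★★★ `mbDensity_ge_detFol_rescaled` — `ρ(gnoBase p)·(1+x₀²)(1+y₀²)·((1+d)·20400L⁴)^{−7∕2}·(1+1∕d)^{−d∕2}∕√det A_F(gnoBase p) ≤ 𝔪(a,ε,p)` (`re a ≠ 0`, `im a ≠ 0`,
  good `ε`; `ρ(gnoBase p)(1+x₀²)(1+y₀²) = (1+x₀²)⁻¹(1+y₀²)⁻¹`, ✓`gnoDensity_gnoBase_mul_jacobian`): the proof of ✓`mbDensity_ge_detFol` run on the pulled-back form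
  `y ↦ Q(gnoScale p y)` after the change of variables `∫ g = (1+x₀²)(1+y₀²)∫ g ∘ gnoScale p`.
WHY (memo2 §1): the leader-side bounds of both cores (w3 g67's ✓`lintegral_uFirst_le`: `(1+x₀²)∕κ_u`; the tip's hub-pinned widths) carry the gnomonic `(1+x₀²)(1+y₀²)`;
a `Λ`-floored `M_ε` does not, so the comparison `… ≤ (1∕128)(2π∕b)^α M_ε` needs at least this rescaled floor on the bulk side.

HONEST LABEL: measure ∕ linear-algebra plumbing at fixed `L`; `stub_core_tip`, `stub_core_end`, `stub_h001_good`, ⟨24197⟩ ∕ ⟨24194⟩ OPEN; own crux ⟨22884⟩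
`LargeFieldMassRefinementTail` OPEN (blocked-on ⟨19935⟩); the Yang–Mills mass gap is NOT proved; no summit is proved by a line.  THEOREMS ONLY (0 `def`, 0 `sorry`),
standard axioms, no instances.  Width seat ym-line-sfw-p2-w2 g60 (cell ym-idea-1, free hands), `--supports stmt-QuantumFields-24197`.
References: [cite: Luscher1983, §2]; [cite: Breitung1994, Lemma 26]; [folklore].
-/

set_option autoImplicit false
set_option synthInstance.maxSize 1024

noncomputable section

open MeasureTheory Quaternion Set Module
open scoped Quaternion BigOperators ENNReal InnerProductSpace
open Literature.MathematicalPhysics.QuantumLattice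
open Literature.MathematicalPhysics.QuantumFieldTheory hiding SU2

namespace Summit.QuantumFields.YangMills.Theorems.SwapVirialDeficit.SectorLaplace

open Summit.QuantumFields.YangMills.Theorems.FemtoTransferGap
open Summit.QuantumFields.YangMills.Theorems.FemtoTransferGap.TT
open Summit.QuantumFields.YangMills.Theorems.VirialFluxGap.RingDeficit
open Summit.QuantumFields.YangMills.Theorems.SwapVirialDeficit.SwapRing
open Summit.QuantumFields.YangMills.Theorems.SwapVirialDeficit.BlowUpRing
open Summit.QuantumFields.YangMills.Theorems.SwapVirialDeficit.Gnomonic (normSq3 normSq3_nonneg)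
open Summit.QuantumFields.YangMills.Theorems.QuantitativeLaplace (integral_exp_neg_mul_half_inner integrable_exp_neg_mul_half_inner inner_pos_of_coercive)
open Literature.Analysis.Asymptotics (det_pos_of_inner_pos)

variable {L : ℕ} [NeZero L]

/-! ## §1 The rescaled ceiling and the follower block -/

/-- ★ **THE RESCALED CEILING**: `Q_{a,ε,p}(gnoScale p y) ≤ 20400L⁴‖y‖²` for every hub `a ≠ 0`, signs, base point `p` and `y` — the size-normalised second jet of
✓`taylor_four_chartDeficit_gnomonic` along the rescaled ray (whose letters have normalised sizes `≤ ‖y‖`, ✓`letterSizes_rescaled_le`). [cite: Luscher1983, §2] -/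
theorem fibQ_gnoScale_le {a : ℍ} (ha : a ≠ 0) (ε : GnoSign L) (p : ℝ × ℝ) (y : GnoFibre L) :
    fibQ a ε p (gnoScale p y) ≤ 20400 * (L : ℝ) ^ 4 * ‖y‖ ^ 2 := by
  obtain ⟨hx, hy, hz, hf⟩ := letterSizes_rescaled_le p y
  have h := ((Gnomonic.taylor_four_chartDeficit_gnomonic z₀ (fun _ => (1 : SU2)) ha ε (gnoFibreEquiv (p, gnoScale p y)) (norm_nonneg y) hx hy hz hf).1 0).2.1
  have eray : (fun t : ℝ => chartDeficit L z₀ (fun _ => (1 : SU2)) (blowUpPoint t (gnomonicPoint a ε (gnoFibreEquiv (p, gnoScale p y))))) =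
      fun t : ℝ => gnoDeficit z₀ (fun _ => 1) a ε (gnoBase p.1 p.2 + t • gnoFibreEmb (gnoScale p y)) :=
    funext fun t => by rw [gnoBase_add_smul_eq_eulerDilate, gnoDeficit_eulerDilate]
  rw [eray] at h
  unfold fibQ
  exact (abs_le.1 h).2

/-- The rescaling fixes the follower block: `gnoScale p (gnoFolToFibre f) = gnoFolToFibre f`. [folklore] -/
theorem gnoScale_gnoFolToFibre (p : ℝ × ℝ) (f : GnoFol L) : gnoScale p (gnoFolToFibre f) = gnoFolToFibre f := by
  apply (gnoFibreBlocksEquiv (L := L)).injective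
  rw [gnoFibreBlocksEquiv_apply, gnoFibreBlocksEquiv_apply, gnoFibreBlocks_gnoScale, gnoFibreBlocks_gnoFolToFibre]
  simp only [Prod.mk.injEq, and_true]
  exact ⟨funext fun _ => by simp, funext fun _ => by simp⟩

/-- The rescaling does not decrease the norm (all weights `≥ 1`). [folklore] -/
theorem norm_le_norm_gnoScale (p : ℝ × ℝ) (y : GnoFibre L) : ‖y‖ ≤ ‖gnoScale p y‖ := by
  have h2 : ‖y‖ ^ 2 ≤ ‖gnoScale p y‖ ^ 2 := by
    rw [EuclideanSpace.real_norm_sq_eq, EuclideanSpace.real_norm_sq_eq]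
    refine Finset.sum_le_sum fun i _ => ?_
    rw [gnoScale_apply, mul_pow]
    have h0 : 1 ≤ gnoFibreScale (L := L) p i := by
      rcases i with (j | j) | (k | fk)
      · exact Real.one_le_sqrt.2 (by nlinarith [sq_nonneg p.1])
      · exact Real.one_le_sqrt.2 (by nlinarith [sq_nonneg p.2])
      · exact le_rfl
      · exact le_rfl
    have h1 : 1 ≤ gnoFibreScale (L := L) p i ^ 2 := by nlinarith
    nlinarith [sq_nonneg (y i)]
  exact (pow_le_pow_iff_left₀ (norm_nonneg _) (norm_nonneg _) two_ne_zero).1 h2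

/-! ## §2 The rescaled lower bound -/

set_option maxHeartbeats 400000 in
/-- ★★★ **THE RESCALED FOLLOWER-DETERMINANT FLOOR.**  Hub `a` with `re a ≠ 0`, `im a ≠ 0`, good signs `ε`, base point `p = (x₀, y₀)`; `A_F` a symmetric follower family with
the form identity at the hub `a` (✓`exists_gnoFolHessian`).  Then, with `d = dim V_F` and `Λ = 20400L⁴`,
`gnoDensity(gnoBase p)·(1+x₀²)(1+y₀²)·((1+d)Λ)^{−7∕2}·(1+1∕d)^{−d∕2}·(det A_F(gnoBase p))^{−1∕2} ≤ 𝔪(a,ε,p)` — ✓`mbDensity_ge_detFol` with the gnomonic Jacobian GAINED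
(`ρ(gnoBase p)(1+x₀²)(1+y₀²) = (1+x₀²)⁻¹(1+y₀²)⁻¹`). [cite: Breitung1994, Lemma 26] [cite: Luscher1983, §2] -/
theorem mbDensity_ge_detFol_rescaled {a : ℍ} (hre : a.re ≠ 0) (him : a.im ≠ 0) {ε : GnoSign L} (hε : GoodSign ε) (p : ℝ × ℝ)
    {AF : GnoCoord L → GnoFol L →ₗ[ℝ] GnoFol L} (hFs : ∀ η, (AF η).IsSymmetric)
    (hFyy : ∀ η (y : GnoFol L), ⟪AF η y, y⟫_ℝ = iteratedFDeriv ℝ 2 (fun y' : GnoFol L => gnoDeficit z₀ (fun _ => 1) a ε (η + gnoFolEmb y')) 0 (fun _ => y)) :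
    gnoDensity (gnoBase p.1 p.2 : GnoCoord L) * ((1 + p.1 ^ 2) * (1 + p.2 ^ 2)) * (((1 + (finrank ℝ (GnoFol L) : ℝ)) * (20400 * (L : ℝ) ^ 4)) ^ (-(7 / 2 : ℝ)) *
        (1 + 1 / (finrank ℝ (GnoFol L) : ℝ)) ^ (-((finrank ℝ (GnoFol L) : ℝ) / 2)) / Real.sqrt (LinearMap.det (AF (gnoBase p.1 p.2)))) ≤
      mbDensity (L := L) a ε p := by
  have ha : a ≠ 0 := fun h => hre (by rw [h]; rfl)
  have hL : (0 : ℝ) < (L : ℝ) := Nat.cast_pos.2 (Nat.pos_of_ne_zero (NeZero.ne L))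
  set η₀ : GnoCoord L := gnoBase p.1 p.2 with hη₀
  set Λ : ℝ := 20400 * (L : ℝ) ^ 4 with hΛ
  have hΛpos : 0 < Λ := by rw [hΛ]; positivity
  -- dimensions (opaque)
  have hd9 := nine_le_finrank_gnoFol (L := L)
  obtain ⟨d, hd⟩ : ∃ d : ℝ, (finrank ℝ (GnoFol L) : ℝ) = d := ⟨_, rfl⟩
  rw [hd] at hd9 ⊢
  have hdpos : 0 < d := by linarith
  have hdn : (finrank ℝ (GnoFol L) : ℝ) = 3 * (Fintype.card (Fol L) : ℝ) := finrank_gnoFol_real (L := L)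
  have hdimL : (finrank ℝ (GnoFibre L) : ℝ) = 7 + d := by
    rw [← hd, hdn]
    have h := card_gnoFibreIdx (L := L)
    rw [finrank_euclideanSpace, h]; push_cast; ring
  -- the fibre Hessian at η₀ and the quadratic form
  obtain ⟨A, hAs, -, hAyy, hAray, -, -, -⟩ := exists_gnoFibreHessian z₀ (fun _ => 1) ha ε
  have hQ0 : ∀ y : GnoFibre L, fibQ a ε p y = ⟪A η₀ y, y⟫_ℝ := fun y => (hAray η₀ y).symm
  -- the pulled-back operator `A'' = S A(η₀) S`, `S = gnoScaleLin p`
  set A'' : GnoFibre L →ₗ[ℝ] GnoFibre L := (gnoScaleLin (L := L) p) ∘ₗ (A η₀) ∘ₗ (gnoScaleLin (L := L) p) with hA''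
  have hSsym := gnoScaleLin_isSymmetric (L := L) p
  have hA''app : ∀ y : GnoFibre L, A'' y = gnoScale p (A η₀ (gnoScale p y)) := fun y => rfl
  have hA''yy : ∀ y : GnoFibre L, ⟪A'' y, y⟫_ℝ = ⟪A η₀ (gnoScale p y), gnoScale p y⟫_ℝ := fun y => by
    rw [hA''app, ← gnoScaleLin_apply, ← gnoScaleLin_apply, hSsym]
  have hA''s : A''.IsSymmetric := fun v w => by
    show ⟪gnoScaleLin p (A η₀ (gnoScaleLin p v)), w⟫_ℝ = ⟪v, gnoScaleLin p (A η₀ (gnoScaleLin p w))⟫_ℝ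
    rw [hSsym, hAs η₀, ← hSsym]
  have hQ : ∀ y : GnoFibre L, fibQ a ε p (gnoScale p y) = ⟪A'' y, y⟫_ℝ := fun y => by rw [hA''yy, hQ0]
  -- coercivity of the fibre form and of the follower block
  set lam : ℝ := min (min (2 * (2 * (‖a‖⁻¹ * a.re) * (‖a‖⁻¹ * ‖a.im‖)) ^ 2 / ((2 + p.1 ^ 2) * (16200 * (L : ℝ) ^ 6)))
        (2 * (‖a‖⁻¹ * ‖a.im‖) ^ 2 / ((2 + p.2 ^ 2) * (16200 * (L : ℝ) ^ 6))))
      (min (1 / (16200 * (L : ℝ) ^ 6)) ((2304 * (L : ℝ) ^ 6 * (Fintype.card (Fol L) : ℝ))⁻¹ / 2)) with hlam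
  have hlampos : 0 < lam := lam_explicit_pos hre him p
  have hcoerA0 : ∀ y : GnoFibre L, lam * ‖y‖ ^ 2 ≤ ⟪A η₀ y, y⟫_ℝ := fun y => by rw [← hQ0]; exact fibQ_coercive_explicit hre him hε p y
  have hcoerA : ∀ y : GnoFibre L, lam * ‖y‖ ^ 2 ≤ ⟪A'' y, y⟫_ℝ := fun y => by
    rw [hA''yy]
    refine le_trans ?_ (hcoerA0 _)
    have h := norm_le_norm_gnoScale p y
    have h0 : 0 ≤ ‖y‖ := norm_nonneg _
    exact mul_le_mul_of_nonneg_left (by nlinarith) hlampos.le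
  have hfol0 : ∀ f : GnoFol L, ⟪A η₀ (gnoFolToFibre f), gnoFolToFibre f⟫_ℝ = ⟪AF η₀ f, f⟫_ℝ := fun f =>
    inner_gnoFibreHessian_fol z₀ (fun _ => 1) ha ε hAyy hFyy η₀ f
  have hfol : ∀ f : GnoFol L, ⟪A'' (gnoFolToFibre f), gnoFolToFibre f⟫_ℝ = ⟪AF η₀ f, f⟫_ℝ := fun f => by
    rw [hA''yy, gnoScale_gnoFolToFibre, hfol0]
  have hcoerF : ∀ f : GnoFol L, lam * ‖f‖ ^ 2 ≤ ⟪AF η₀ f, f⟫_ℝ := fun f => by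
    rw [← hfol0, ← norm_gnoFolToFibre f]; exact hcoerA0 _
  have hdetF : 0 < LinearMap.det (AF η₀) := det_pos_of_inner_pos (hFs η₀) (inner_pos_of_coercive hlampos hcoerF)
  -- the bilinear form
  set B : GnoFibre L →ₗ[ℝ] GnoFibre L →ₗ[ℝ] ℝ :=
    LinearMap.mk₂ ℝ (fun v w : GnoFibre L => ⟪A'' v, w⟫_ℝ) (fun v v' w => by rw [map_add, inner_add_left]) (fun c v w => by rw [map_smul, real_inner_smul_left, smul_eq_mul])
      (fun v w w' => by rw [inner_add_right]) (fun c v w => by rw [real_inner_smul_right, smul_eq_mul]) with hB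
  have hBapp : ∀ v w : GnoFibre L, B v w = ⟪A'' v, w⟫_ℝ := fun v w => rfl
  have hBsym : ∀ v w, B v w = B w v := fun v w => by rw [hBapp, hBapp, hA''s v w]; exact real_inner_comm (A'' w) v
  have hBpsd : ∀ v, 0 ≤ B v v := fun v => by rw [hBapp]; exact le_trans (mul_nonneg hlampos.le (sq_nonneg _)) (hcoerA v)
  -- the block maps
  set E : GnoFibre L ≃ᵐ ((Fin 2 → ℝ) × (Fin 2 → ℝ)) × (Fin 3 → ℝ) × (Fol L → Fin 3 → ℝ) := gnoFibreBlocksEquiv (L := L) with hE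
  set ι₁ : ((Fin 2 → ℝ) × (Fin 2 → ℝ)) × (Fin 3 → ℝ) → GnoFibre L := fun ℓ => E.symm (ℓ.1, (ℓ.2, (0 : Fol L → Fin 3 → ℝ))) with hι₁
  set ι₂ : (Fol L → Fin 3 → ℝ) → GnoFibre L := fun F => E.symm (((0 : Fin 2 → ℝ), (0 : Fin 2 → ℝ)), ((0 : Fin 3 → ℝ), F)) with hι₂
  have hEadd : ∀ y y' : GnoFibre L, E (y + y') = E y + E y' := fun y y' => by
    show gnoFibreBlocks (y + y') = gnoFibreBlocks y + gnoFibreBlocks y'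
    rfl
  have hdecomp : ∀ (ℓ : ((Fin 2 → ℝ) × (Fin 2 → ℝ)) × (Fin 3 → ℝ)) (F : Fol L → Fin 3 → ℝ), E.symm (ℓ.1, (ℓ.2, F)) = ι₁ ℓ + ι₂ F := fun ℓ F => by
    apply E.injective
    rw [hEadd, hι₁, hι₂, E.apply_symm_apply, E.apply_symm_apply, E.apply_symm_apply]
    simp
  have hι₂fol : ∀ f : GnoFol L, ι₂ (gnoFolBlocksEquiv f) = gnoFolToFibre f := fun f => by
    rw [hι₂]
    apply E.injective
    rw [E.apply_symm_apply, hE, gnoFibreBlocksEquiv_apply, gnoFibreBlocks_gnoFolToFibre, gnoFolBlocksEquiv_apply]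
  -- norm of the leader-transverse block
  have hnorm₁ : ∀ ℓ : ((Fin 2 → ℝ) × (Fin 2 → ℝ)) × (Fin 3 → ℝ), ‖ι₁ ℓ‖ ^ 2 = (∑ i, ℓ.1.1 i ^ 2) + (∑ i, ℓ.1.2 i ^ 2) + ∑ i, ℓ.2 i ^ 2 := fun ℓ => by
    have h := norm_sq_gnoFibre (ι₁ ℓ)
    have hb : gnoFibreBlocks (ι₁ ℓ) = (ℓ.1, (ℓ.2, (0 : Fol L → Fin 3 → ℝ))) := by
      rw [← gnoFibreBlocksEquiv_apply, ← hE, hι₁, E.apply_symm_apply]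
    rw [hb] at h
    simp only [Fin.sum_univ_two, Fin.sum_univ_three, normSq3, Pi.zero_apply] at h ⊢
    rw [h]
    simp [Finset.sum_const_zero]
  -- §A the block inequality (LEAD): θ = 1/d, c = 1/2
  have hθ : 0 < 1 / d := by positivity
  have hmS : Measurable fun y : GnoFibre L => gnoScale (L := L) p y := by
    have h := Measurable.comp (measurable_gnoScale_prod (L := L)) ((measurable_const (a := p)).prodMk (measurable_id (α := GnoFibre L)))
    exact h
  have hmQS : Measurable fun y : GnoFibre L => fibQ a ε p (gnoScale p y) := by
    have h := Measurable.comp (measurable_fibQ ha ε p) hmS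
    exact h
  have hmeasB : Measurable fun y : GnoFibre L => B y y := by
    have e : (fun y : GnoFibre L => B y y) = fun y => fibQ a ε p (gnoScale p y) := funext fun y => by rw [hBapp, hQ]
    rw [e]; exact hmQS
  have hmι₁ : Measurable ι₁ := E.symm.measurable.comp (measurable_fst.prodMk (measurable_snd.prodMk measurable_const))
  have hmι₂ : Measurable ι₂ := E.symm.measurable.comp (measurable_const.prodMk (measurable_const.prodMk measurable_id))
  have hblock := lintegral_prod_gaussian_block_ge (volume : Measure (((Fin 2 → ℝ) × (Fin 2 → ℝ)) × (Fin 3 → ℝ))) (volume : Measure (Fol L → Fin 3 → ℝ))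
    B hBsym hBpsd hθ (by norm_num : (0 : ℝ) ≤ 1 / 2) ι₁ ι₂ (hmeasB.comp hmι₁).aemeasurable (hmeasB.comp hmι₂).aemeasurable
  -- §B the right side is ∫_{V_L} e^{−½Q}
  have hRHS : ∫⁻ q : (((Fin 2 → ℝ) × (Fin 2 → ℝ)) × (Fin 3 → ℝ)) × (Fol L → Fin 3 → ℝ), ENNReal.ofReal (Real.exp (-(1 / 2 * B (ι₁ q.1 + ι₂ q.2) (ι₁ q.1 + ι₂ q.2))))
      ∂((volume : Measure (((Fin 2 → ℝ) × (Fin 2 → ℝ)) × (Fin 3 → ℝ))).prod (volume : Measure (Fol L → Fin 3 → ℝ))) =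
      ∫⁻ y : GnoFibre L, ENNReal.ofReal (Real.exp (-(fibQ a ε p (gnoScale p y) / 2))) := by
    -- through `prodAssoc` and `E.symm`
    have hG : Measurable fun y : GnoFibre L => ENNReal.ofReal (Real.exp (-(fibQ a ε p (gnoScale p y) / 2))) :=
      ENNReal.measurable_ofReal.comp (Real.measurable_exp.comp (hmQS.div_const 2).neg)
    have h1 : ∫⁻ y : GnoFibre L, ENNReal.ofReal (Real.exp (-(fibQ a ε p (gnoScale p y) / 2))) =
        ∫⁻ b, ENNReal.ofReal (Real.exp (-(fibQ a ε p (gnoScale p (E.symm b)) / 2))) ∂(volume : Measure (((Fin 2 → ℝ) × (Fin 2 → ℝ)) × (Fin 3 → ℝ) × (Fol L → Fin 3 → ℝ))) := by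
      rw [← (volume_preserving_gnoFibreBlocksEquiv (L := L)).symm.lintegral_comp_emb E.symm.measurableEmbedding]
    have h2 : (volume : Measure (((Fin 2 → ℝ) × (Fin 2 → ℝ)) × (Fin 3 → ℝ) × (Fol L → Fin 3 → ℝ))) =
        Measure.map MeasurableEquiv.prodAssoc (((volume : Measure ((Fin 2 → ℝ) × (Fin 2 → ℝ))).prod (volume : Measure (Fin 3 → ℝ))).prod
          (volume : Measure (Fol L → Fin 3 → ℝ))) := by
      rw [Measure.prodAssoc_prod]; rfl
    have hG' : Measurable fun b : ((Fin 2 → ℝ) × (Fin 2 → ℝ)) × (Fin 3 → ℝ) × (Fol L → Fin 3 → ℝ) => ENNReal.ofReal (Real.exp (-(fibQ a ε p (gnoScale p (E.symm b)) / 2))) :=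
      hG.comp E.symm.measurable
    rw [h1, h2, lintegral_map hG' MeasurableEquiv.prodAssoc.measurable]
    refine lintegral_congr fun q => ?_
    simp only [MeasurableEquiv.prodAssoc, MeasurableEquiv.coe_mk, Equiv.prodAssoc_apply]
    rw [hdecomp (q.1.1, q.1.2) q.2, hBapp, ← hQ]
    ring_nf
  -- §C the follower factor
  have hfolInt : ∫⁻ F : Fol L → Fin 3 → ℝ, ENNReal.ofReal (Real.exp (-(1 / 2 * ((1 + 1 / d) * B (ι₂ F) (ι₂ F))))) =
      ENNReal.ofReal ((2 * Real.pi / (1 + 1 / d)) ^ (d / 2) / Real.sqrt (LinearMap.det (AF η₀))) := by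
    have hs : 0 < 1 + 1 / d := by positivity
    have h1 : ∫⁻ F : Fol L → Fin 3 → ℝ, ENNReal.ofReal (Real.exp (-(1 / 2 * ((1 + 1 / d) * B (ι₂ F) (ι₂ F))))) =
        ∫⁻ f : GnoFol L, ENNReal.ofReal (Real.exp (-((1 + 1 / d) * ((1 / 2) * ⟪AF η₀ f, f⟫_ℝ)))) := by
      have hm : Measurable fun F : Fol L → Fin 3 → ℝ => ENNReal.ofReal (Real.exp (-(1 / 2 * ((1 + 1 / d) * B (ι₂ F) (ι₂ F))))) :=
        ENNReal.measurable_ofReal.comp (Real.measurable_exp.comp (((hmeasB.comp hmι₂).const_mul _).const_mul _).neg)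
      rw [← (volume_preserving_gnoFolBlocksEquiv (L := L)).lintegral_comp hm]
      refine lintegral_congr fun f => ?_
      rw [hι₂fol, hBapp, hfol]; ring_nf
    rw [h1, ← ofReal_integral_eq_lintegral_ofReal (integrable_exp_neg_mul_half_inner hlampos hcoerF hs) (ae_of_all _ fun f => (Real.exp_pos _).le),
      integral_exp_neg_mul_half_inner (hFs η₀) hlampos hcoerF hs, hd]
  -- §D the leader-transverse factor
  have hleadInt : ENNReal.ofReal (Real.sqrt (Real.pi / (1 / 2 * ((1 + d) * Λ))) ^ 7) ≤
      ∫⁻ ℓ : ((Fin 2 → ℝ) × (Fin 2 → ℝ)) × (Fin 3 → ℝ), ENNReal.ofReal (Real.exp (-(1 / 2 * ((1 + d) * B (ι₁ ℓ) (ι₁ ℓ))))) := by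
    have hc : 0 < 1 / 2 * ((1 + d) * Λ) := by positivity
    rw [← integral_exp_neg_mul_blocksT, ofReal_integral_eq_lintegral_ofReal (integrable_exp_neg_mul_blocksT hc) (ae_of_all _ fun q => (Real.exp_pos _).le)]
    refine lintegral_mono fun ℓ => ENNReal.ofReal_le_ofReal (Real.exp_le_exp.2 (neg_le_neg ?_))
    rw [hBapp, ← hQ]
    have h := fibQ_gnoScale_le ha ε p (ι₁ ℓ)
    rw [hnorm₁] at h
    have hd1 : 0 ≤ 1 + d := by linarith
    nlinarith [h, hd1]
  -- §E assemble in `ℝ≥0∞`, then in `ℝ`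
  have hchain : ENNReal.ofReal (Real.sqrt (Real.pi / (1 / 2 * ((1 + d) * Λ))) ^ 7) * ENNReal.ofReal ((2 * Real.pi / (1 + 1 / d)) ^ (d / 2) / Real.sqrt (LinearMap.det (AF η₀))) ≤
      ∫⁻ y : GnoFibre L, ENNReal.ofReal (Real.exp (-(fibQ a ε p (gnoScale p y) / 2))) := by
    rw [← hRHS, ← hfolInt]
    have hθinv : (1 / d)⁻¹ = d := by rw [one_div, inv_inv]
    rw [hθinv] at hblock
    exact le_trans (mul_le_mul' hleadInt le_rfl) hblock
  -- back to real integrals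
  have hint : Integrable fun y : GnoFibre L => Real.exp (-(fibQ a ε p (gnoScale p y) / 2)) := by
    have h := integrable_exp_neg_mul_half_inner hlampos hcoerA (s := 1) one_pos
    refine h.congr (ae_of_all _ fun y => ?_)
    show Real.exp (-(1 * ((1 / 2) * ⟪A'' y, y⟫_ℝ))) = Real.exp (-(fibQ a ε p (gnoScale p y) / 2))
    rw [hQ]; ring_nf
  rw [← ofReal_integral_eq_lintegral_ofReal hint (ae_of_all _ fun y => (Real.exp_pos _).le), ← ENNReal.ofReal_mul (by positivity)] at hchain
  have hIpos : 0 ≤ ∫ y : GnoFibre L, Real.exp (-(fibQ a ε p (gnoScale p y) / 2)) := integral_nonneg fun y => (Real.exp_pos _).le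
  have hreal := (ENNReal.ofReal_le_ofReal_iff hIpos).1 hchain
  -- the change of variables `∫ e^{−Q/2} = (1+x₀²)(1+y₀²)·∫ e^{−Q∘S/2}` and the normalisation `(2π)^{−α}`, `α = (7 + d)/2`
  have hmg : Measurable fun y : GnoFibre L => Real.exp (-(fibQ a ε p y / 2)) := Real.measurable_exp.comp ((measurable_fibQ ha ε p).div_const 2).neg
  have hcov := integral_comp_gnoScale p hmg (fun y => (Real.exp_pos _).le)
  unfold mbDensity alpha
  rw [hdimL, hcov]
  have hρ : 0 ≤ gnoDensity (gnoBase p.1 p.2 : GnoCoord L) := (gnoDensity_pos _).le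
  have hJ : 0 ≤ (1 + p.1 ^ 2) * (1 + p.2 ^ 2) := by positivity
  rw [show gnoDensity (gnoBase p.1 p.2 : GnoCoord L) * ((2 * Real.pi) ^ ((7 + d) / 2))⁻¹ *
      ((1 + p.1 ^ 2) * (1 + p.2 ^ 2) * ∫ y : GnoFibre L, Real.exp (-(fibQ a ε p (gnoScale p y) / 2))) =
      gnoDensity (gnoBase p.1 p.2 : GnoCoord L) * ((1 + p.1 ^ 2) * (1 + p.2 ^ 2)) *
        (((2 * Real.pi) ^ ((7 + d) / 2))⁻¹ * ∫ y : GnoFibre L, Real.exp (-(fibQ a ε p (gnoScale p y) / 2))) by ring]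
  refine mul_le_mul_of_nonneg_left ?_ (mul_nonneg hρ hJ)
  -- target: ((1+d)Λ)^{-7/2} (1+1/d)^{-d/2} / √det ≤ ((2π)^{(7+d)/2})⁻¹ * ∫ e^{-Q/2}
  have hsqrt7 : Real.sqrt (Real.pi / (1 / 2 * ((1 + d) * Λ))) ^ 7 = (2 * Real.pi) ^ ((7 : ℝ) / 2) * ((1 + d) * Λ) ^ (-(7 / 2 : ℝ)) := by
    have hx : 0 < (1 + d) * Λ := by positivity
    rw [show Real.pi / (1 / 2 * ((1 + d) * Λ)) = 2 * Real.pi / ((1 + d) * Λ) by field_simp, Real.sqrt_eq_rpow, ← Real.rpow_natCast,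
      ← Real.rpow_mul (by positivity), Real.div_rpow (by positivity) hx.le, Real.rpow_neg hx.le, div_eq_mul_inv]
    norm_num
  have hpow : (2 * Real.pi / (1 + 1 / d)) ^ (d / 2) = (2 * Real.pi) ^ (d / 2) * (1 + 1 / d) ^ (-(d / 2)) := by
    rw [Real.div_rpow (by positivity) (by positivity), Real.rpow_neg (by positivity), div_eq_mul_inv]
  have h2pi : (2 * Real.pi) ^ ((7 + d) / 2) = (2 * Real.pi) ^ ((7 : ℝ) / 2) * (2 * Real.pi) ^ (d / 2) := by
    rw [← Real.rpow_add (by positivity)]; ring_nf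
  rw [hsqrt7, hpow] at hreal
  have h2pipos : 0 < (2 * Real.pi) ^ ((7 + d) / 2) := by positivity
  rw [le_inv_mul_iff₀ h2pipos, h2pi]
  calc (2 * Real.pi) ^ ((7 : ℝ) / 2) * (2 * Real.pi) ^ (d / 2) * (((1 + d) * Λ) ^ (-(7 / 2 : ℝ)) * (1 + 1 / d) ^ (-(d / 2)) / Real.sqrt (LinearMap.det (AF η₀)))
      = (2 * Real.pi) ^ ((7 : ℝ) / 2) * ((1 + d) * Λ) ^ (-(7 / 2 : ℝ)) * ((2 * Real.pi) ^ (d / 2) * (1 + 1 / d) ^ (-(d / 2)) / Real.sqrt (LinearMap.det (AF η₀))) := by ring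
    _ ≤ ∫ y : GnoFibre L, Real.exp (-(fibQ a ε p (gnoScale p y) / 2)) := hreal

/-- ★★ **The rescaled floor with the absolute constant `e^{−1∕2}` and the weight `(1+x₀²)⁻¹(1+y₀²)⁻¹`**:
`(1+x₀²)⁻¹(1+y₀²)⁻¹·((1+d)·20400L⁴)^{−7∕2}·e^{−1∕2}·(det A_F(gnoBase p))^{−1∕2} ≤ 𝔪(a,ε,p)`. [cite: Breitung1994, Lemma 26] -/
theorem mbDensity_ge_detFol_rescaled' {a : ℍ} (hre : a.re ≠ 0) (him : a.im ≠ 0) {ε : GnoSign L} (hε : GoodSign ε) (p : ℝ × ℝ)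
    {AF : GnoCoord L → GnoFol L →ₗ[ℝ] GnoFol L} (hFs : ∀ η, (AF η).IsSymmetric)
    (hFyy : ∀ η (y : GnoFol L), ⟪AF η y, y⟫_ℝ = iteratedFDeriv ℝ 2 (fun y' : GnoFol L => gnoDeficit z₀ (fun _ => 1) a ε (η + gnoFolEmb y')) 0 (fun _ => y)) :
    (1 + p.1 ^ 2)⁻¹ * (1 + p.2 ^ 2)⁻¹ * (((1 + (finrank ℝ (GnoFol L) : ℝ)) * (20400 * (L : ℝ) ^ 4)) ^ (-(7 / 2 : ℝ)) *
        Real.exp (-(1 / 2 : ℝ)) / Real.sqrt (LinearMap.det (AF (gnoBase p.1 p.2)))) ≤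
      mbDensity (L := L) a ε p := by
  refine le_trans ?_ (mbDensity_ge_detFol_rescaled hre him hε p hFs hFyy)
  rw [← gnoDensity_gnoBase_mul_jacobian (L := L) p]
  have hρ : 0 ≤ gnoDensity (gnoBase p.1 p.2 : GnoCoord L) * ((1 + p.1 ^ 2) * (1 + p.2 ^ 2)) := mul_nonneg (gnoDensity_pos _).le (by positivity)
  refine mul_le_mul_of_nonneg_left (div_le_div_of_nonneg_right (mul_le_mul_of_nonneg_left ?_ (Real.rpow_nonneg (by positivity) _)) (Real.sqrt_nonneg _)) hρ
  have h := exp_neg_half_le_one_add_inv_rpow (finrank ℝ (GnoFol L))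
  exact h

end Summit.QuantumFields.YangMills.Theorems.SwapVirialDeficit.SectorLaplace

end
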